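import Summits.QuantumFields.YangMills.Theorems.UnitScaleTiltProp7GramDifferenceNearRow
import Summits.QuantumFields.YangMills.Theorems.UnitScaleTiltProp7PropagatorComparisonOnCutoff
import Summits.QuantumFields.YangMills.Theorems.UnitScaleTiltProp7TopMeanComparisonOnPropagator
import Summits.QuantumFields.YangMills.Theorems.UnitScaleTiltProp7TopMeanAdjointTwoBackgrounds
import Summits.QuantumFields.YangMills.Theorems.UnitScaleTiltProp7AdjointTopMeanPlateauFixed
import Summits.QuantumFields.YangMills.Theorems.UnitScaleTiltProp7MassivePropagatorTail
import Summits.QuantumFields.YangMills.Theorems.UnitScaleTiltProp7TopMeanFrameWalkLengths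
import Summits.QuantumFields.YangMills.Theorems.UnitScaleTiltProp7TopMeanFrameWalkFlat
import HarnessLib

/-!
# Route `UnitScaleTilt`, crux K1 «MinimiserStabilityRegPr» (stmt-QuantumFields-19200), EX row `hGF[Lift]` (curved member) — **LOD LINE, PEN (L5″) «hloc px5-half»:
# THE (RN-near) ROW AT THE MEMBER, EVERY px5 ROW DISCHARGED** — ✓`Prop7GramDifferenceNearRow.norm_gram_apply_sub_le_near` (p757045) instantiated at `E := SiteL2K` (fine), `C :=` the
lift space, `S_1 := ι∘Q_1` (flat system of record), `S_W := ι∘Q_W`, adjoint letters `T_1, T_W`, ABSTRACT massive maps `A_1, G_1, A_W, G_W`, plateau cut-off `X` (`χ·`) and fattened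
cut-off `Xt` (`χ̃·`), coarse vector `c = ι d` with `d` supported in `N` (`χ = 1` and `φ = 0` on `N`'s blocks); its rows are supplied BY NAME: `hSW`,`hT1c` ← ✓p755451
`norm_lift_topMean_le` + duality · `hS` ← ✓p755451 `norm_lift_topMean_sub_flat_le_of_tail` · `hRB1` ← ✓p755265 `norm_massiveInv_sub_le_of_cutoff_fixed` · `hT` ← ✓p755981
`norm_adjoint_sub_adjoint_le` · `hXpT` ← ✓p757702 · `hτv`,`hτu` ← ✓p756369∕✓p756828 · frames ← ✓p754796 + ✓p758184 + ✓`Prop7TopMeanFrameWalkFlat` (block flatness) ·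
`hXpXt`,`hXt` ← cut-off geometry.  What stays DISPLAYED is geometry (cut-offs, flatness of `W♭` on the blocks meeting `supp χ`, the Agmon phase∕window) and the abstract massive
data — routeR-w2 g13's «hloc at the member» (2026-08-30 03:15:06Z) meets this file in the middle.

Cell `ym3-torus` (HUMAN RULING D-0037, YM ladder rung R3 — NOT d = 4, NOT infinite volume, NOT a mass gap, NOT Clay).  Width seat `ym3-torus-px5` gen 11.  THEOREMS ONLY (0 `def`,
0 `sorry`); `--supports stmt-QuantumFields-19200 --as helper`, count-neutral.  HONEST LABEL (★★OWNER RULING №33 (6)): curved γ-row supplier line (LOD localisation), pen (L5″); a dock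
of landed rows; nothing of (3.49), Thm 3.1∕3.3, `h349`, `hGF`, EX ∕ 19200 is proved here; the constant `ε_N` is printed, not estimated.

References: T. Bałaban, CMP **99** (1985) 389–434 [Balaban1985BackgroundPropagators] ((3.16), (3.19) p.393, (3.21)–(3.24) p.394, (3.49) p.399, Thm 3.3 p.399, (3.100)–(3.105)
pp.413–414); CMP **98** (1985) 17–51 [Balaban1985Averaging] ((19)–(20) p.21, (97) p.32).
-/

set_option autoImplicit false

noncomputable section

open scoped BigOperators Matrix.Norms.L2Operator InnerProductSpace ComplexConjugate

namespace Summit.QuantumFields.YangMills.Theorems.Prop7GramDifferenceNearRowMember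

open Literature.MathematicalPhysics.QuantumFieldTheory.Balaban1983to89
open T4Continuum BlockAveraging
open BlockAveraging (Idx)
open B7Prop1Explicit (U1 treeWord l1 disp)
open B5Eq118OneStroke (iterBlockOf iterBlock mem_iterBlock)
open B15DeterminingSets (embIter)
open B10Eq27TorusAxialLog (holT axialT rel transl)
open B7TransferAnalyticMean (meanCLM)
open B11Eq103H1Complex (SiteL2K)
open Summit.QuantumFields.YangMills.Theorems.Prop8Chart (emlIterU)
open Literature.MathematicalPhysics.QuantumFieldTheory.Balaban1983to89.T3ContinuumYM3Torus
open T3SectALandauChart (eta bgUnits)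
open T3PrintedRegularMinimiser (RegPr)
open T3PrintedRegularOrbits (sites_eq)
open T3LevelShift (siteShift)
open Summit.QuantumFields.YangMills.Theorems.Prop7SectET3Transport (periodsT3)
open Summit.QuantumFields.YangMills.Theorems.Prop7SectET3HilbertLetters (W₂ toL2S DL2 covLapSite)
open Summit.QuantumFields.YangMills.Theorems.Prop7MassivePropagatorAgmonLetters (norm_toL2S_smul_le)
open Summit.QuantumFields.YangMills.Theorems.Prop7GramDifferenceNearRow (norm_gram_apply_sub_le_near)
open Summit.QuantumFields.YangMills.Theorems.Prop7PropagatorComparisonOnCutoff (norm_massiveInv_sub_le_of_cutoff_fixed)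
open Summit.QuantumFields.YangMills.Theorems.Prop7TopMeanComparisonOnPropagator (norm_lift_topMean_le norm_lift_topMean_sub_flat_le_of_tail)
open Summit.QuantumFields.YangMills.Theorems.Prop7TopMeanAdjointTwoBackgrounds (norm_adjoint_sub_adjoint_le)
open Summit.QuantumFields.YangMills.Theorems.Prop7AdjointTopMeanPlateauFixed (symm_adjoint_apply_eq_zero_off_support blockLift_orthogonal cutoff_adjoint_blockLift_eq_self)
open Summit.QuantumFields.YangMills.Theorems.Prop7MassivePropagatorTail (norm_tail_le_of_massive_eq norm_tail_le_of_massive_eq_twice)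
open Summit.QuantumFields.YangMills.Theorems.Prop7TopMeanFrameRows (norm_frame_one_sub_one_le frameRow_one frameRow_of_walkFlat)
open Summit.QuantumFields.YangMills.Theorems.Prop7TopMeanFrameWalkLengths (frameWalkLengths one_le_frameWalkBound)
open Summit.QuantumFields.YangMills.Theorems.Prop7TopMeanFrameWalkFlat (walkFlat_of_blockFlat)
open B13BondAveragingReadingNumerals (embIter_mem_iterBlock')

variable (F : T3Family) {n K : ℕ} (h : n ≤ K) {c₀ c₁ : ℝ} [Fact (0 < c₀)] [Fact (0 < c₁)] {ε₀ : ℝ} (hε₀ : 0 < ε₀) (hε7 : 10 ^ 7 * (F.L : ℝ) ^ 3 * ε₀ ≤ 1)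
  (hreg1 : RegPr F n K ε₀ (1 : GaugeField (F.P K) 0 (Matrix.specialUnitaryGroup (Fin 2) ℂ)))
  (Q1 : SiteL2K ℂ 3 (periodsT3 F K) c₀ W₂ →ₗ[ℂ] (Site (F.P K) (K - n) → Matrix (Fin 2) (Fin 2) ℂ))
  (hseq1 : ∀ lam : Site (F.P K) 0 → Matrix (Fin 2) (Fin 2) ℂ, ∃ ns : (j : ℕ) → Site (F.P K) j → Matrix (Fin 2) (Fin 2) ℂ, ns 0 = lam ∧
        (∀ (j : ℕ) (y : Site (F.P K) (j + 1)), ns (j + 1) y = ns j (emb y) - meanCLM (Idx (F.P K)) (Matrix (Fin 2) (Fin 2) ℂ) fun i : Idx (F.P K) =>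
          ns j (emb y) - ((holT (emlIterU j (bgUnits F K (1 : GaugeField (F.P K) 0 (Matrix.specialUnitaryGroup (Fin 2) ℂ)))) (emb y) (stairWord i.2.1 (off i.1)) : (Matrix (Fin 2) (Fin 2) ℂ)ˣ) : Matrix (Fin 2) (Fin 2) ℂ) *
            ns j (transl (emb y) (disp (stairWord i.2.1 (off i.1)))) * (((holT (emlIterU j (bgUnits F K (1 : GaugeField (F.P K) 0 (Matrix.specialUnitaryGroup (Fin 2) ℂ)))) (emb y) (stairWord i.2.1 (off i.1)))⁻¹ : (Matrix (Fin 2) (Fin 2) ℂ)ˣ) : Matrix (Fin 2) (Fin 2) ℂ)) ∧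
        ns (K - n) = Q1 (toL2S F K c₀ lam))
  (ι : (Site (F.P K) (K - n) → Matrix (Fin 2) (Fin 2) ℂ) →ₗ[ℂ] SiteL2K ℂ 3 (periodsT3 F n) c₁ W₂)
  (hι : ∀ c, ι c = toL2S F n c₁ (fun z => c (siteShift (sites_eq F n K h) z)))
  (T1 : SiteL2K ℂ 3 (periodsT3 F n) c₁ W₂ →ₗ[ℂ] SiteL2K ℂ 3 (periodsT3 F K) c₀ W₂)
  (hT1 : ∀ (l : SiteL2K ℂ 3 (periodsT3 F K) c₀ W₂) (f : SiteL2K ℂ 3 (periodsT3 F n) c₁ W₂), ⟪ι (Q1 l), f⟫_ℂ = ⟪l, T1 f⟫_ℂ)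
  (W : GaugeField (F.P K) 0 (Matrix.specialUnitaryGroup (Fin 2) ℂ)) (hregW : RegPr F n K ε₀ W)
  (QW : SiteL2K ℂ 3 (periodsT3 F K) c₀ W₂ →ₗ[ℂ] (Site (F.P K) (K - n) → Matrix (Fin 2) (Fin 2) ℂ))
  (hseqW : ∀ lam : Site (F.P K) 0 → Matrix (Fin 2) (Fin 2) ℂ, ∃ ns : (j : ℕ) → Site (F.P K) j → Matrix (Fin 2) (Fin 2) ℂ, ns 0 = lam ∧
        (∀ (j : ℕ) (y : Site (F.P K) (j + 1)), ns (j + 1) y = ns j (emb y) - meanCLM (Idx (F.P K)) (Matrix (Fin 2) (Fin 2) ℂ) fun i : Idx (F.P K) =>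
          ns j (emb y) - ((holT (emlIterU j (bgUnits F K W)) (emb y) (stairWord i.2.1 (off i.1)) : (Matrix (Fin 2) (Fin 2) ℂ)ˣ) : Matrix (Fin 2) (Fin 2) ℂ) *
            ns j (transl (emb y) (disp (stairWord i.2.1 (off i.1)))) * (((holT (emlIterU j (bgUnits F K W)) (emb y) (stairWord i.2.1 (off i.1)))⁻¹ : (Matrix (Fin 2) (Fin 2) ℂ)ˣ) : Matrix (Fin 2) (Fin 2) ℂ)) ∧
        ns (K - n) = QW (toL2S F K c₀ lam))
  (TW : SiteL2K ℂ 3 (periodsT3 F n) c₁ W₂ →ₗ[ℂ] SiteL2K ℂ 3 (periodsT3 F K) c₀ W₂)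
  (hTW : ∀ (l : SiteL2K ℂ 3 (periodsT3 F K) c₀ W₂) (f : SiteL2K ℂ 3 (periodsT3 F n) c₁ W₂), ⟪ι (QW l), f⟫_ℂ = ⟪l, TW f⟫_ℂ)
  {a : ℝ} (ha : 0 < a)

include h hε₀ hε7 hreg1 hseq1 hι hT1 hregW hseqW in
/-- ★ **THE ADJOINT LETTER IS BOUNDED LIKE THE LIFTED MEAN**: `‖T_1 c‖ ≤ √(25κ∕8)·‖c‖` (duality with ✓`norm_lift_topMean_le`: `‖T_1c‖² = re⟪ι(Q_1(T_1 c)), c⟫ ≤ √(25κ∕8)‖T_1c‖‖c‖`).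
[cite: Balaban1985BackgroundPropagators, (3.16) p.393, (3.24) p.394] -/
theorem norm_adjoint_le (c : SiteL2K ℂ 3 (periodsT3 F n) c₁ W₂) : ‖T1 c‖ ≤ Real.sqrt ((25 / 8) * (c₁ * ((((F.P K).L : ℝ) ^ (F.P K).d) ^ (K - n))⁻¹ / c₀)) * ‖c‖ := by
  have hc₀ : 0 < c₀ := Fact.out
  have hc₁ : 0 < c₁ := Fact.out
  set v : SiteL2K ℂ 3 (periodsT3 F K) c₀ W₂ := T1 c with hv
  have hκ0 : 0 ≤ Real.sqrt ((25 / 8) * (c₁ * ((((F.P K).L : ℝ) ^ (F.P K).d) ^ (K - n))⁻¹ / c₀)) := Real.sqrt_nonneg _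
  have hS : ‖ι (Q1 v)‖ ≤ Real.sqrt ((25 / 8) * (c₁ * ((((F.P K).L : ℝ) ^ (F.P K).d) ^ (K - n))⁻¹ / c₀)) * ‖v‖ := by
    have := (norm_lift_topMean_le F hε₀ hε7 (1 : GaugeField (F.P K) 0 (Matrix.specialUnitaryGroup (Fin 2) ℂ)) hreg1 Q1 hseq1 W hregW QW hseqW h ι hι ((toL2S F K c₀).symm v)).1
    simpa only [LinearEquiv.apply_symm_apply] using this
  have hsq : ‖v‖ ^ 2 ≤ Real.sqrt ((25 / 8) * (c₁ * ((((F.P K).L : ℝ) ^ (F.P K).d) ^ (K - n))⁻¹ / c₀)) * ‖v‖ * ‖c‖ := by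
    have e1 : ‖v‖ ^ 2 = RCLike.re ⟪v, T1 c⟫_ℂ := (inner_self_eq_norm_sq v).symm
    rw [e1, ← hT1]
    calc RCLike.re ⟪ι (Q1 v), c⟫_ℂ ≤ ‖⟪ι (Q1 v), c⟫_ℂ‖ := RCLike.re_le_norm _
      _ ≤ ‖ι (Q1 v)‖ * ‖c‖ := norm_inner_le_norm _ _
      _ ≤ Real.sqrt ((25 / 8) * (c₁ * ((((F.P K).L : ℝ) ^ (F.P K).d) ^ (K - n))⁻¹ / c₀)) * ‖v‖ * ‖c‖ := mul_le_mul_of_nonneg_right hS (norm_nonneg _)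
  by_cases hv0 : ‖v‖ = 0
  · rw [hv0]; positivity
  · have hvpos : 0 < ‖v‖ := lt_of_le_of_ne (norm_nonneg _) (Ne.symm hv0)
    have : ‖v‖ * ‖v‖ ≤ (Real.sqrt ((25 / 8) * (c₁ * ((((F.P K).L : ℝ) ^ (F.P K).d) ^ (K - n))⁻¹ / c₀)) * ‖c‖) * ‖v‖ := by nlinarith [hsq]
    exact le_of_mul_le_mul_right this hvpos

include h hε₀ hε7 hreg1 hseq1 hι hT1 hregW hseqW hTW ha in
set_option maxHeartbeats 400000 in
/-- ★★★ **THE (RN-near) ROW AT THE MEMBER** — ✓`norm_gram_apply_sub_le_near` with every px5 row supplied by name (module docstring); displayed: cut-off geometry (`χ` plateau with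
bond steps `θ` and block oscillation `θ′` about `χc`, `|χ| ≤ 1`; fattened `χ̃` with `|χ̃| ≤ 1`, `|1 − χ̃| ≤ 1`, `χ = 1` on `supp χ̃`), the two-background rows of `W♭` against `1♭`
(`‖W♭ − 1♭‖ ≤ δη` on the bonds meeting `supp χ`; `‖W♭ − 1‖ ≤ δ′` on the bonds of the blocks meeting `supp χ`, `4mδ′ ≤ 1`, `m = max 1 (d(L^{K−n} − 1))`), the support `N` of `d`
inside the plateau (`χ = 1`, `φ = 0` on the blocks where `d ≠ 0`), the Agmon phase∕window of ✓p749343 (`φ ≥ R` off `{χ̃ = 1}`), and the abstract massive data of both systems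
(`A = Δ + a·T(ι(Q·))`, two-sided inverses, coercivity `m_W, m_1`, energies, `‖G‖ ≤ ν`).  Conclusion: `‖S_1(G_1(G_1(T_1 c))) − S_W(G_W(G_W(T_W c)))‖ ≤ ε_N·‖c‖`, `c = ι d`, `ε_N` PRINTED.
[cite: Balaban1985BackgroundPropagators, (3.21)-(3.24) p.394, (3.49) p.399, Thm 3.3 p.399, (3.105) p.414; Balaban1985Averaging, (97) p.32] -/
theorem norm_gram_apply_sub_le_near_member
    -- cut-off geometry
    (χ χt : Site (F.P K) 0 → ℝ) (χc : Site (F.P K) (K - n) → ℝ) {θ θ' δ δ' : ℝ} (hθ : 0 ≤ θ) (hθ' : 0 ≤ θ') (hδ : 0 ≤ δ) (hδ' : 0 ≤ δ')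
    (hχ1 : ∀ x, |χ x| ≤ 1) (hχ : ∀ (x : Site (F.P K) 0) (μ : Fin 3), |χ (x.shift μ) - χ x| ≤ θ)
    (hχblk : ∀ x : Site (F.P K) 0, |χ x - χc (iterBlockOf (K - n) x)| ≤ θ')
    (hχt1 : ∀ x, |χt x| ≤ 1) (hχt2 : ∀ x, |1 - χt x| ≤ 1) (hplat : ∀ x, χt x ≠ 0 → χ x = 1)
    (hmδ : 4 * (((max 1 ((F.P K).d * ((F.P K).L ^ (K - n) - 1))) : ℕ) : ℝ) * δ' ≤ 1)
    -- the two backgrounds near `supp χ`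
    (hUV : ∀ b : PBond (F.P K) 0, (χ b.tgt ≠ 0 ∨ χ b.src ≠ 0) →
      ‖((bgUnits F K W b : (Matrix (Fin 2) (Fin 2) ℂ)ˣ) : Matrix (Fin 2) (Fin 2) ℂ) - ((bgUnits F K (1 : GaugeField (F.P K) 0 (Matrix.specialUnitaryGroup (Fin 2) ℂ)) b : (Matrix (Fin 2) (Fin 2) ℂ)ˣ) : Matrix (Fin 2) (Fin 2) ℂ)‖ ≤ δ * eta F n K)
    (hflat : ∀ Y : Site (F.P K) (K - n), (∃ x ∈ iterBlock (K - n) Y, χ x ≠ 0) → ∀ b : PBond (F.P K) 0,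
      iterBlockOf (K - n) b.src = Y → iterBlockOf (K - n) b.tgt = Y → ‖((bgUnits F K W b : (Matrix (Fin 2) (Fin 2) ℂ)ˣ) : Matrix (Fin 2) (Fin 2) ℂ) - 1‖ ≤ δ')
    -- the coarse vector: supported inside the plateau, phase `0` there
    (d : Site (F.P K) (K - n) → Matrix (Fin 2) (Fin 2) ℂ) (hχN : ∀ x : Site (F.P K) 0, d (iterBlockOf (K - n) x) ≠ 0 → χ x = 1)
    (φ : Site (F.P K) 0 → ℝ) (φc : Site (F.P K) (K - n) → ℝ) {θa θa' : ℝ} (hθa' : 0 ≤ θa')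
    (hφ : ∀ b : PBond (F.P K) 0, |φ b.tgt - φ b.src| ≤ θa) (hφc : ∀ x : Site (F.P K) 0, |φ x - φc (iterBlockOf (K - n) x)| ≤ θa')
    {δ₁ : ℝ} (hδ₁ : 0 ≤ δ₁)
    (hδw : 3 * ((eta F n K)⁻¹) ^ 2 * (Real.exp θa - 1) ^ 2 + a * ((25 / 8) * (c₁ * ((((F.P K).L : ℝ) ^ (F.P K).d) ^ (K - n))⁻¹ / c₀)) * (Real.exp θa' - 1) ^ 2 ≤ δ₁ ^ 2)
    (hwin : Real.sqrt (max 2 (16 * c₀ * ((F.L : ℝ) ^ (K - n)) ^ 3 / (a * c₁))) * δ₁ ≤ 1 / 10)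
    {R : ℝ} (hR : ∀ x, χt x ≠ 1 → R ≤ φ x) (hφN : ∀ x : Site (F.P K) 0, d (iterBlockOf (K - n) x) ≠ 0 → φ x = 0)
    -- the cut-offs as maps and the abstract massive data
    (X Xt : SiteL2K ℂ 3 (periodsT3 F K) c₀ W₂ →ₗ[ℂ] SiteL2K ℂ 3 (periodsT3 F K) c₀ W₂) (hX : ∀ l : Site (F.P K) 0 → Matrix (Fin 2) (Fin 2) ℂ, X (toL2S F K c₀ l) = toL2S F K c₀ (fun x => χ x • l x))
    (hXt : ∀ l : Site (F.P K) 0 → Matrix (Fin 2) (Fin 2) ℂ, Xt (toL2S F K c₀ l) = toL2S F K c₀ (fun x => χt x • l x))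
    (A1 AW G1 GW : SiteL2K ℂ 3 (periodsT3 F K) c₀ W₂ →ₗ[ℂ] SiteL2K ℂ 3 (periodsT3 F K) c₀ W₂)
    (hA1 : ∀ w, A1 w = covLapSite F n K c₀ (1 : GaugeField (F.P K) 0 (Matrix.specialUnitaryGroup (Fin 2) ℂ)) w + (a : ℂ) • T1 (ι (Q1 w)))
    (hAW : ∀ w, AW w = covLapSite F n K c₀ W w + (a : ℂ) • TW (ι (QW w)))
    (hWG : ∀ v, AW (GW v) = v) (h1G : ∀ v, A1 (G1 v) = v) (hGWA : ∀ v, GW (AW v) = v) (hG1A : ∀ v, G1 (A1 v) = v)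
    {mW m1 : ℝ} (hmW : 0 < mW) (hm1 : 0 < m1)
    (hcoW : ∀ u : SiteL2K ℂ 3 (periodsT3 F K) c₀ W₂, mW * ‖u‖ ^ 2 ≤ RCLike.re ⟪u, AW u⟫_ℂ) (hco1 : ∀ u : SiteL2K ℂ 3 (periodsT3 F K) c₀ W₂, m1 * ‖u‖ ^ 2 ≤ RCLike.re ⟪u, A1 u⟫_ℂ)
    (henergyW : ∀ w : SiteL2K ℂ 3 (periodsT3 F K) c₀ W₂, ‖DL2 F n K c₀ W w‖ ^ 2 ≤ RCLike.re ⟪w, AW w⟫_ℂ) (henergy1 : ∀ w : SiteL2K ℂ 3 (periodsT3 F K) c₀ W₂, ‖DL2 F n K c₀ (1 : GaugeField (F.P K) 0 (Matrix.specialUnitaryGroup (Fin 2) ℂ)) w‖ ^ 2 ≤ RCLike.re ⟪w, A1 w⟫_ℂ)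
    {ν : ℝ} (hν : 0 ≤ ν) (hG1n : ∀ v, ‖G1 v‖ ≤ ν * ‖v‖) (hGWn : ∀ v, ‖GW v‖ ≤ ν * ‖v‖) :
    ‖ι (Q1 (G1 (G1 (T1 (ι d))))) - ι (QW (GW (GW (TW (ι d)))))‖ ≤ ((Real.sqrt (2 * (c₁ * ((((F.P K).L : ℝ) ^ (F.P K).d) ^ (K - n))⁻¹ / c₀)) * (2 * (4500 * (F.L : ℝ) ^ 2 * ε₀) + 16 * (((max 1 ((F.P K).d * ((F.P K).L ^ (K - n) - 1))) : ℕ) : ℝ) * δ')) * (ν ^ 2 * Real.sqrt ((25 / 8) * (c₁ * ((((F.P K).L : ℝ) ^ (F.P K).d) ^ (K - n))⁻¹ / c₀))) + (2 * Real.sqrt ((25 / 8) * (c₁ * ((((F.P K).L : ℝ) ^ (F.P K).d) ^ (K - n))⁻¹ / c₀))) * (Real.exp (-R) * (8 * Real.sqrt (max 2 (16 * c₀ * ((F.L : ℝ) ^ (K - n)) ^ 3 / (a * c₁))) ^ 2) ^ 2 * Real.sqrt ((25 / 8) * (c₁ * ((((F.P K).L : ℝ) ^ (F.P K).d) ^ (K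 - n))⁻¹ / c₀))) + Real.sqrt ((25 / 8) * (c₁ * ((((F.P K).L : ℝ) ^ (F.P K).d) ^ (K - n))⁻¹ / c₀)) * ((Real.sqrt mW⁻¹ * (1 + Real.sqrt mW⁻¹) * ((Real.sqrt 3 * (eta F n K)⁻¹ * θ + Real.sqrt 24 * δ + 2 * (Real.sqrt 3 * (eta F n K)⁻¹ * θ) * (Real.sqrt 24 * δ)) * Real.sqrt m1⁻¹ + ((Real.sqrt 3 * (eta F n K)⁻¹ * θ + Real.sqrt 24 * δ + 2 * (Real.sqrt 3 * (eta F n K)⁻¹ * θ) * (Real.sqrt 24 * δ)) + a * ((25 / 4) * (c₁ * ((((F.P K).L : ℝ) ^ (F.P K).d) ^ (K - n))⁻¹ / c₀) * θ' + 2 * Real.sqrt ((25 / 8) * (c₁ * ((((F.P K).L : ℝ) ^ (F.P K).d) ^ (K - n))⁻¹ / c₀)) * (Real.sqrt (2 * (c₁ * ((((F.P K).L : ℝ) ^ (F.P K).d) ^ (K - n))⁻¹ / c₀)) * (2 * (4500 * (F.L : ℝ) ^ 2 * ε₀) + 2 * 0 + 2 * (8 * (((max 1 ((F.P K).d * ((F.P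 K).L ^ (K - n) - 1))) : ℕ) : ℝ) * δ'))))) * m1⁻¹) + Real.sqrt m1⁻¹ * (1 + Real.sqrt m1⁻¹) * ((Real.sqrt 3 * (eta F n K)⁻¹ * θ + Real.sqrt 24 * δ + 2 * (Real.sqrt 3 * (eta F n K)⁻¹ * θ) * (Real.sqrt 24 * δ)) * Real.sqrt m1⁻¹ + ((Real.sqrt 3 * (eta F n K)⁻¹ * θ + Real.sqrt 24 * δ + 2 * (Real.sqrt 3 * (eta F n K)⁻¹ * θ) * (Real.sqrt 24 * δ)) + a * ((25 / 4) * (c₁ * ((((F.P K).L : ℝ) ^ (F.P K).d) ^ (K - n))⁻¹ / c₀) * θ' + 2 * Real.sqrt ((25 / 8) * (c₁ * ((((F.P K).L : ℝ) ^ (F.P K).d) ^ (K - n))⁻¹ / c₀)) * 0)) * m1⁻¹)) * (ν * Real.sqrt ((25 / 8) * (c₁ * ((((F.P K).L : ℝ) ^ (F.P K).d) ^ (K - n))⁻¹ / c₀))) + 2 * ν * (Real.exp (-R) * (8 * Real.sqrt (max 2 (16 * c₀ * ((F.L : ℝ) ^ (K - n)) ^ 3 / (a * c₁))) ^ 2)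 * Real.sqrt ((25 / 8) * (c₁ * ((((F.P K).L : ℝ) ^ (F.P K).d) ^ (K - n))⁻¹ / c₀))) + ν * ((Real.sqrt mW⁻¹ * (1 + Real.sqrt mW⁻¹) * ((Real.sqrt 3 * (eta F n K)⁻¹ * θ + Real.sqrt 24 * δ + 2 * (Real.sqrt 3 * (eta F n K)⁻¹ * θ) * (Real.sqrt 24 * δ)) * Real.sqrt m1⁻¹ + ((Real.sqrt 3 * (eta F n K)⁻¹ * θ + Real.sqrt 24 * δ + 2 * (Real.sqrt 3 * (eta F n K)⁻¹ * θ) * (Real.sqrt 24 * δ)) + a * ((25 / 4) * (c₁ * ((((F.P K).L : ℝ) ^ (F.P K).d) ^ (K - n))⁻¹ / c₀) * θ' + 2 * Real.sqrt ((25 / 8) * (c₁ * ((((F.P K).L : ℝ) ^ (F.P K).d) ^ (K - n))⁻¹ / c₀)) * (Real.sqrt (2 * (c₁ * ((((F.P K).L : ℝ) ^ (F.P K).d) ^ (K - n))⁻¹ / c₀)) * (2 * (4500 * (F.L : ℝ) ^ 2 * ε₀) + 2 * 0 + 2 * (8 * (((max 1 ((F.P K).d * ((F.P K).L ^ (K -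 n) - 1))) : ℕ) : ℝ) * δ'))))) * m1⁻¹) + Real.sqrt m1⁻¹ * (1 + Real.sqrt m1⁻¹) * ((Real.sqrt 3 * (eta F n K)⁻¹ * θ + Real.sqrt 24 * δ + 2 * (Real.sqrt 3 * (eta F n K)⁻¹ * θ) * (Real.sqrt 24 * δ)) * Real.sqrt m1⁻¹ + ((Real.sqrt 3 * (eta F n K)⁻¹ * θ + Real.sqrt 24 * δ + 2 * (Real.sqrt 3 * (eta F n K)⁻¹ * θ) * (Real.sqrt 24 * δ)) + a * ((25 / 4) * (c₁ * ((((F.P K).L : ℝ) ^ (F.P K).d) ^ (K - n))⁻¹ / c₀) * θ' + 2 * Real.sqrt ((25 / 8) * (c₁ * ((((F.P K).L : ℝ) ^ (F.P K).d) ^ (K - n))⁻¹ / c₀)) * 0)) * m1⁻¹)) * Real.sqrt ((25 / 8) * (c₁ * ((((F.P K).L : ℝ) ^ (F.P K).d) ^ (K - n))⁻¹ / c₀))) + ν ^ 2 * (Real.sqrt (2 * (c₁ * ((((F.P K).L : ℝ) ^ (F.P K).d) ^ (K - n))⁻¹ / c₀)) * (2 * (4500 * (F.L : ℝ) ^ 2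 * ε₀) + 2 * 0 + 2 * (8 * (((max 1 ((F.P K).d * ((F.P K).L ^ (K - n) - 1))) : ℕ) : ℝ) * δ'))))) * ‖ι d‖ := by
  have hc₀ : 0 < c₀ := Fact.out
  have hc₁ : 0 < c₁ := Fact.out
  have hη : 0 < eta F n K := T3SectALandauChart.eta_pos F n K
  have hL := (F.P K).L_pos
  have hk : K - n ≤ (F.P K).m + (F.P K).K := by show K - n ≤ F.m + K; have := F.hm; omega
  have hCS0 : 0 ≤ Real.sqrt ((25 / 8) * (c₁ * ((((F.P K).L : ℝ) ^ (F.P K).d) ^ (K - n))⁻¹ / c₀)) := Real.sqrt_nonneg _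
  -- frame data from block flatness
  have hm1' := one_le_frameWalkBound F (n := n) (K := K)
  have hδU0 : (0 : ℝ) ≤ 8 * (((max 1 ((F.P K).d * ((F.P K).L ^ (K - n) - 1))) : ℕ) : ℝ) * δ' := by positivity
  have hflat_t : ∀ Y : Site (F.P K) (K - n), (∃ x ∈ iterBlock (K - n) Y, χt x ≠ 0) → ∀ b : PBond (F.P K) 0,
      iterBlockOf (K - n) b.src = Y → iterBlockOf (K - n) b.tgt = Y → ‖((bgUnits F K W b : (Matrix (Fin 2) (Fin 2) ℂ)ˣ) : Matrix (Fin 2) (Fin 2) ℂ) - 1‖ ≤ δ' :=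
    fun Y hY => hflat Y (by obtain ⟨x, hx, hx0⟩ := hY; exact ⟨x, hx, by rw [hplat x hx0]; exact one_ne_zero⟩)
  have hCUχ := frameRow_of_walkFlat F W χ hδ' hm1' hmδ (frameWalkLengths F χ) (walkFlat_of_blockFlat F W χ hflat)
  have hCUχt := frameRow_of_walkFlat F W χt hδ' hm1' hmδ (frameWalkLengths F χt) (walkFlat_of_blockFlat F W χt hflat_t)
  -- blocks of `supp d` meet `supp χ`
  have hdχ : ∀ Y : Site (F.P K) (K - n), d Y ≠ 0 → ∃ x ∈ iterBlock (K - n) Y, χ x ≠ 0 := by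
    intro Y hY
    refine ⟨embIter (K - n) Y, embIter_mem_iterBlock' hk Y, ?_⟩
    have hb : iterBlockOf (K - n) (embIter (K - n) Y) = Y := (mem_iterBlock (K - n) Y _).mp (embIter_mem_iterBlock' hk Y)
    rw [hχN _ (by rw [hb]; exact hY)]; exact one_ne_zero
  -- field ↔ vector conversions for the fattened cut-off
  have hXt_sub : ∀ y : Site (F.P K) 0 → Matrix (Fin 2) (Fin 2) ℂ, toL2S F K c₀ y - Xt (toL2S F K c₀ y) = toL2S F K c₀ (fun x => (1 - χt x) • y x) := by
    intro y
    rw [hXt y, ← map_sub]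
    congr 1; funext x; rw [Pi.sub_apply, sub_smul, one_smul]
  -- the rows of ✓p757045
  have hSW : ∀ l : SiteL2K ℂ 3 (periodsT3 F K) c₀ W₂, ‖ι (QW l)‖ ≤ Real.sqrt ((25 / 8) * (c₁ * ((((F.P K).L : ℝ) ^ (F.P K).d) ^ (K - n))⁻¹ / c₀)) * ‖l‖ := by
    intro l
    have := (norm_lift_topMean_le F hε₀ hε7 (1 : GaugeField (F.P K) 0 (Matrix.specialUnitaryGroup (Fin 2) ℂ)) hreg1 Q1 hseq1 W hregW QW hseqW h ι hι ((toL2S F K c₀).symm l)).2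
    simpa only [LinearEquiv.apply_symm_apply] using this
  have hS : ∀ u : SiteL2K ℂ 3 (periodsT3 F K) c₀ W₂, ‖ι (Q1 u) - ι (QW u)‖ ≤ (Real.sqrt (2 * (c₁ * ((((F.P K).L : ℝ) ^ (F.P K).d) ^ (K - n))⁻¹ / c₀)) * (2 * (4500 * (F.L : ℝ) ^ 2 * ε₀) + 16 * (((max 1 ((F.P K).d * ((F.P K).L ^ (K - n) - 1))) : ℕ) : ℝ) * δ')) * ‖u‖ + (2 * Real.sqrt ((25 / 8) * (c₁ * ((((F.P K).L : ℝ) ^ (F.P K).d) ^ (K - n))⁻¹ / c₀))) * ‖u - Xt u‖ := by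
    intro u
    set uf := (toL2S F K c₀).symm u with huf
    have hu : toL2S F K c₀ uf = u := LinearEquiv.apply_symm_apply _ _
    have key := norm_lift_topMean_sub_flat_le_of_tail F hε₀ hε7 W hregW QW hseqW h ι hι hreg1 Q1 hseq1 χt hχt1 hδ' hm1' hmδ
      (frameWalkLengths F χt) (walkFlat_of_blockFlat F W χt hflat_t) uf le_rfl
    rw [← hu, norm_sub_rev, hXt_sub uf]
    calc _ ≤ _ := key
      _ = _ := by ring
  have hRB1 : ∀ hh : SiteL2K ℂ 3 (periodsT3 F K) c₀ W₂, X hh = hh → ‖G1 hh - GW hh‖ ≤ (Real.sqrt mW⁻¹ * (1 + Real.sqrt mW⁻¹) * ((Real.sqrt 3 * (eta F n K)⁻¹ * θ + Real.sqrt 24 * δ + 2 * (Real.sqrt 3 * (eta F n K)⁻¹ * θ) * (Real.sqrt 24 * δ)) * Real.sqrt m1⁻¹ + ((Real.sqrt 3 * (eta F n K)⁻¹ * θ + Real.sqrt 24 * δ + 2 * (Real.sqrt 3 * (eta F n K)⁻¹ * θ) * (Real.sqrt 24 * δ)) + a * ((25 / 4) * (c₁ * ((((F.P K).L : ℝ)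 ^ (F.P K).d) ^ (K - n))⁻¹ / c₀) * θ' + 2 * Real.sqrt ((25 / 8) * (c₁ * ((((F.P K).L : ℝ) ^ (F.P K).d) ^ (K - n))⁻¹ / c₀)) * (Real.sqrt (2 * (c₁ * ((((F.P K).L : ℝ) ^ (F.P K).d) ^ (K - n))⁻¹ / c₀)) * (2 * (4500 * (F.L : ℝ) ^ 2 * ε₀) + 2 * 0 + 2 * (8 * (((max 1 ((F.P K).d * ((F.P K).L ^ (K - n) - 1))) : ℕ) : ℝ) * δ'))))) * m1⁻¹) + Real.sqrt m1⁻¹ * (1 + Real.sqrt m1⁻¹) * ((Real.sqrt 3 * (eta F n K)⁻¹ * θ + Real.sqrt 24 * δ + 2 * (Real.sqrt 3 * (eta F n K)⁻¹ * θ) * (Real.sqrt 24 * δ)) * Real.sqrt m1⁻¹ + ((Real.sqrt 3 * (eta F n K)⁻¹ * θ + Real.sqrt 24 * δ + 2 * (Real.sqrt 3 * (eta F n K)⁻¹ * θ) * (Real.sqrt 24 * δ)) + a * ((25 / 4) * (c₁ * ((((F.P K).L : ℝ) ^ (F.P K).d) ^ (K - n))⁻¹ / c₀) * θ' + 2 *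 Real.sqrt ((25 / 8) * (c₁ * ((((F.P K).L : ℝ) ^ (F.P K).d) ^ (K - n))⁻¹ / c₀)) * 0)) * m1⁻¹)) * ‖hh‖ := by
    intro hh hXh
    rw [norm_sub_rev]
    exact norm_massiveInv_sub_le_of_cutoff_fixed F h hε₀ hε7 (1 : GaugeField (F.P K) 0 (Matrix.specialUnitaryGroup (Fin 2) ℂ)) hreg1 Q1 hseq1 ι hι T1 hT1 W hregW QW hseqW TW hTW χ χc hθ hθ' hδ hχ1 hχ hχblk hUV
      le_rfl hδU0 (frameRow_one F χ) hCUχ ha.le X hX AW A1 GW G1 hA1 hAW hWG h1G hGWA hG1A hmW hm1 hcoW hco1 henergyW henergy1 hh hXh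
  have hXpXt : ∀ v : SiteL2K ℂ 3 (periodsT3 F K) c₀ W₂, X (Xt v) = Xt v := by
    intro v
    set y := (toL2S F K c₀).symm v
    have hv : toL2S F K c₀ y = v := LinearEquiv.apply_symm_apply _ _
    rw [← hv, hXt y, hX]
    congr 1; funext x
    by_cases hx : χt x = 0
    · rw [hx, zero_smul, smul_zero]
    · rw [hplat x hx, one_smul]
  have hXtn : ∀ v : SiteL2K ℂ 3 (periodsT3 F K) c₀ W₂, ‖Xt v‖ ≤ ‖v‖ := by
    intro v
    set y := (toL2S F K c₀).symm v
    have hv : toL2S F K c₀ y = v := LinearEquiv.apply_symm_apply _ _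
    rw [← hv, hXt y]
    have := norm_toL2S_smul_le F (c₀ := c₀) χt zero_le_one hχt1 y
    rwa [one_mul] at this
  have hT1c : ‖T1 (ι d)‖ ≤ Real.sqrt ((25 / 8) * (c₁ * ((((F.P K).L : ℝ) ^ (F.P K).d) ^ (K - n))⁻¹ / c₀)) * ‖ι d‖ := norm_adjoint_le F h hε₀ hε7 hreg1 Q1 hseq1 ι hι T1 hT1 W hregW QW hseqW (ι d)
  have hT : ‖T1 (ι d) - TW (ι d)‖ ≤ (Real.sqrt (2 * (c₁ * ((((F.P K).L : ℝ) ^ (F.P K).d) ^ (K - n))⁻¹ / c₀)) * (2 * (4500 * (F.L : ℝ) ^ 2 * ε₀) + 2 * 0 + 2 * (8 * (((max 1 ((F.P K).d * ((F.P K).L ^ (K - n) - 1))) : ℕ) : ℝ) * δ'))) * ‖ι d‖ :=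
    norm_adjoint_sub_adjoint_le F hε₀ hε7 (1 : GaugeField (F.P K) 0 (Matrix.specialUnitaryGroup (Fin 2) ℂ)) hreg1 Q1 hseq1 W hregW QW hseqW h ι hι T1 hT1 TW hTW d le_rfl hδU0
      (fun Y _ x _ => norm_frame_one_sub_one_le F Y x) (fun Y hY x hx => hCUχ Y (hdχ Y hY) x hx)
  have hXpT : X (T1 (ι d)) = T1 (ι d) := cutoff_adjoint_blockLift_eq_self F (1 : GaugeField (F.P K) 0 (Matrix.specialUnitaryGroup (Fin 2) ℂ)) Q1 hseq1 h ι hι T1 hT1 X χ hX d hχN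
  -- the propagated fields and their tails
  set wf : Site (F.P K) 0 → Matrix (Fin 2) (Fin 2) ℂ := (toL2S F K c₀).symm (T1 (ι d)) with hwf
  set vf : Site (F.P K) 0 → Matrix (Fin 2) (Fin 2) ℂ := (toL2S F K c₀).symm (G1 (T1 (ι d))) with hvf
  set uf : Site (F.P K) 0 → Matrix (Fin 2) (Fin 2) ℂ := (toL2S F K c₀).symm (G1 (G1 (T1 (ι d)))) with huf
  have hw' : toL2S F K c₀ wf = T1 (ι d) := LinearEquiv.apply_symm_apply _ _
  have hv' : toL2S F K c₀ vf = G1 (T1 (ι d)) := LinearEquiv.apply_symm_apply _ _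
  have hu' : toL2S F K c₀ uf = G1 (G1 (T1 (ι d))) := LinearEquiv.apply_symm_apply _ _
  have hAv : covLapSite F n K c₀ (1 : GaugeField (F.P K) 0 (Matrix.specialUnitaryGroup (Fin 2) ℂ)) (toL2S F K c₀ vf) + (a : ℂ) • T1 (ι (Q1 (toL2S F K c₀ vf))) = toL2S F K c₀ wf := by
    rw [hv', hw', ← hA1, h1G]
  have hAu : covLapSite F n K c₀ (1 : GaugeField (F.P K) 0 (Matrix.specialUnitaryGroup (Fin 2) ℂ)) (toL2S F K c₀ uf) + (a : ℂ) • T1 (ι (Q1 (toL2S F K c₀ uf))) = toL2S F K c₀ vf := by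
    rw [hu', hv', ← hA1, h1G]
  have hφw : ∀ x, wf x ≠ 0 → φ x = 0 := by
    intro x hx
    refine hφN x fun hd => hx ?_
    exact symm_adjoint_apply_eq_zero_off_support F (1 : GaugeField (F.P K) 0 (Matrix.specialUnitaryGroup (Fin 2) ℂ)) Q1 hseq1 ι (blockLift_orthogonal F h ι hι) T1 hT1 d x hd
  have htv := norm_tail_le_of_massive_eq F h hε₀ hε7 (1 : GaugeField (F.P K) 0 (Matrix.specialUnitaryGroup (Fin 2) ℂ)) hreg1 Q1 hseq1 ι hι T1 hT1 ha φ φc hθa' hφ hφc hδ₁ hδw hwin χt hχt2 hR vf wf hφw hAv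
  have htu := norm_tail_le_of_massive_eq_twice F h hε₀ hε7 (1 : GaugeField (F.P K) 0 (Matrix.specialUnitaryGroup (Fin 2) ℂ)) hreg1 Q1 hseq1 ι hι T1 hT1 ha φ φc hθa' hφ hφc hδ₁ hδw hwin χt hχt2 hR uf vf wf hφw hAv hAu
  rw [hw'] at htv htu
  have hCP0 : 0 ≤ Real.exp (-R) * (8 * Real.sqrt (max 2 (16 * c₀ * ((F.L : ℝ) ^ (K - n)) ^ 3 / (a * c₁))) ^ 2) := by positivity
  have hCP0' : 0 ≤ Real.exp (-R) * (8 * Real.sqrt (max 2 (16 * c₀ * ((F.L : ℝ) ^ (K - n)) ^ 3 / (a * c₁))) ^ 2) ^ 2 := by positivity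
  have hτv : ‖G1 (T1 (ι d)) - Xt (G1 (T1 (ι d)))‖ ≤ (Real.exp (-R) * (8 * Real.sqrt (max 2 (16 * c₀ * ((F.L : ℝ) ^ (K - n)) ^ 3 / (a * c₁))) ^ 2) * Real.sqrt ((25 / 8) * (c₁ * ((((F.P K).L : ℝ) ^ (F.P K).d) ^ (K - n))⁻¹ / c₀))) * ‖ι d‖ := by
    rw [← hv', hXt_sub vf]
    calc _ ≤ Real.exp (-R) * (8 * Real.sqrt (max 2 (16 * c₀ * ((F.L : ℝ) ^ (K - n)) ^ 3 / (a * c₁))) ^ 2) * ‖T1 (ι d)‖ := htv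
      _ ≤ Real.exp (-R) * (8 * Real.sqrt (max 2 (16 * c₀ * ((F.L : ℝ) ^ (K - n)) ^ 3 / (a * c₁))) ^ 2) * (Real.sqrt ((25 / 8) * (c₁ * ((((F.P K).L : ℝ) ^ (F.P K).d) ^ (K - n))⁻¹ / c₀)) * ‖ι d‖) := mul_le_mul_of_nonneg_left hT1c hCP0
      _ = _ := by ring
  have hτu : ‖G1 (G1 (T1 (ι d))) - Xt (G1 (G1 (T1 (ι d))))‖ ≤ (Real.exp (-R) * (8 * Real.sqrt (max 2 (16 * c₀ * ((F.L : ℝ) ^ (K - n)) ^ 3 / (a * c₁))) ^ 2) ^ 2 * Real.sqrt ((25 / 8) * (c₁ * ((((F.P K).L : ℝ) ^ (F.P K).d) ^ (K - n))⁻¹ / c₀))) * ‖ι d‖ := by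
    rw [← hu', hXt_sub uf]
    calc _ ≤ Real.exp (-R) * (8 * Real.sqrt (max 2 (16 * c₀ * ((F.L : ℝ) ^ (K - n)) ^ 3 / (a * c₁))) ^ 2) ^ 2 * ‖T1 (ι d)‖ := htu
      _ ≤ Real.exp (-R) * (8 * Real.sqrt (max 2 (16 * c₀ * ((F.L : ℝ) ^ (K - n)) ^ 3 / (a * c₁))) ^ 2) ^ 2 * (Real.sqrt ((25 / 8) * (c₁ * ((((F.P K).L : ℝ) ^ (F.P K).d) ^ (K - n))⁻¹ / c₀)) * ‖ι d‖) := mul_le_mul_of_nonneg_left hT1c hCP0'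
      _ = _ := by ring
  -- nonnegativity of the constants and the knit
  have hdS0 : 0 ≤ (Real.sqrt (2 * (c₁ * ((((F.P K).L : ℝ) ^ (F.P K).d) ^ (K - n))⁻¹ / c₀)) * (2 * (4500 * (F.L : ℝ) ^ 2 * ε₀) + 16 * (((max 1 ((F.P K).d * ((F.P K).L ^ (K - n) - 1))) : ℕ) : ℝ) * δ')) := by positivity
  have hsC0 : 0 ≤ (2 * Real.sqrt ((25 / 8) * (c₁ * ((((F.P K).L : ℝ) ^ (F.P K).d) ^ (K - n))⁻¹ / c₀))) := by positivity
  have hcG0 : 0 ≤ (Real.sqrt mW⁻¹ * (1 + Real.sqrt mW⁻¹) * ((Real.sqrt 3 * (eta F n K)⁻¹ * θ + Real.sqrt 24 * δ + 2 * (Real.sqrt 3 * (eta F n K)⁻¹ * θ) * (Real.sqrt 24 * δ)) * Real.sqrt m1⁻¹ + ((Real.sqrt 3 * (eta F n K)⁻¹ * θ + Real.sqrt 24 * δ + 2 * (Real.sqrt 3 * (eta F n K)⁻¹ * θ) * (Real.sqrt 24 * δ)) + a * ((25 / 4) * (c₁ * ((((F.P K).L : ℝ) ^ (F.P K).d) ^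 (K - n))⁻¹ / c₀) * θ' + 2 * Real.sqrt ((25 / 8) * (c₁ * ((((F.P K).L : ℝ) ^ (F.P K).d) ^ (K - n))⁻¹ / c₀)) * (Real.sqrt (2 * (c₁ * ((((F.P K).L : ℝ) ^ (F.P K).d) ^ (K - n))⁻¹ / c₀)) * (2 * (4500 * (F.L : ℝ) ^ 2 * ε₀) + 2 * 0 + 2 * (8 * (((max 1 ((F.P K).d * ((F.P K).L ^ (K - n) - 1))) : ℕ) : ℝ) * δ'))))) * m1⁻¹) + Real.sqrt m1⁻¹ * (1 + Real.sqrt m1⁻¹) * ((Real.sqrt 3 * (eta F n K)⁻¹ * θ + Real.sqrt 24 * δ + 2 * (Real.sqrt 3 * (eta F n K)⁻¹ * θ) * (Real.sqrt 24 * δ)) * Real.sqrt m1⁻¹ + ((Real.sqrt 3 * (eta F n K)⁻¹ * θ + Real.sqrt 24 * δ + 2 * (Real.sqrt 3 * (eta F n K)⁻¹ * θ) * (Real.sqrt 24 * δ)) + a * ((25 / 4) * (c₁ * ((((F.P K).L : ℝ) ^ (F.P K).d) ^ (K - n))⁻¹ / c₀) * θ' + 2 * Real.sqrt ((25 / 8)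 * (c₁ * ((((F.P K).L : ℝ) ^ (F.P K).d) ^ (K - n))⁻¹ / c₀)) * 0)) * m1⁻¹)) := by positivity
  have key := norm_gram_apply_sub_le_near (ι ∘ₗ Q1) (ι ∘ₗ QW) T1 TW G1 GW X Xt hCS0 hν hdS0 hsC0 hcG0
    (fun l => hSW l) hG1n hGWn (fun u => hS u) hRB1 hXpXt hXtn (ι d) hT1c hT hXpT hτv hτu
  simpa only [LinearMap.comp_apply] using key

end Summit.QuantumFields.YangMills.Theorems.Prop7GramDifferenceNearRowMember
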